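import Literature.NumberTheory.EllipticCurves.TateModuleProofs
import Literature.NumberTheory.EllipticCurves.TorsionCardinality
import HarnessLib

/-!
# `rank_{ℤ_p} T_p(E) = dim_{ℚ_p} V_p(E) = 2` for `p ≠ char F`, unconditionally (Silverman, *AEC*, III.7.1(a))

Topic `NumberTheory/EllipticCurves` (trunk T-ELLARITH); a sibling `…Proofs` file of `TateModule`.
It **discharges** the named facts

* `WeierstrassCurve.finrank_tateModule_eq_two W p` (`TateModule`; Silverman, *AEC*, Prop. III.7.1(a):
  `T_p(E) ≅ ℤ_p × ℤ_p`, i.e. `rank_{ℤ_p} T_p(E) = 2`, for a prime `p ≠ char F`) —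
  `WeierstrassCurve.finrank_tateModule_eq_two_holds`;
* `WeierstrassCurve.finrank_rationalTateModule_eq_two W p` (`TateModule`; Prop. III.7.1(a) with
  Remark 7.2: `dim_{ℚ_p} V_p(E) = 2`) — `WeierstrassCurve.finrank_rationalTateModule_eq_two_holds`,

by assembling three tree results along the printed proof ("This follows immediately from
(III.6.4b)", p. 88; PDF p. 83 of the held text):

1. `WeierstrassCurve.card_torsionBy_eq_sq` (`TorsionCardinality`): `#E(L)[n] = n²` for `E` elliptic
   over an algebraically closed `L` and `n ≠ 0` in `L` — Cor. III.6.4(b), proved there by the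
   elementary fibre count of `x ∘ [n] = Φₙ/ΨSqₙ` on top of the multiplication-by-`n` formula
   (`DivisionPolynomialMultiplication`, Exercise 3.7(d),(f));
2. hence the named fact `card_torsionPoints_eq_sq W F̄` (`GaloisAction`) for the base change of `W`
   to `F̄ = AlgebraicClosure F` (an elliptic curve: `instIsEllipticBaseChange`);
3. `finrank_tateModule_eq_two_of_card_torsionPoints_eq_sq`,
   `finrank_rationalTateModule_eq_two_of_card_torsionPoints_eq_sq` (`TateModuleProofs`):
   `#E[pᵏ] = p^{2k}` for all `k` forces compatible bases `E[pᵏ] ≅ (ℤ/pᵏ)²` and `T_p E ≅ ℤ_p²`,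
   and `V_p = ℚ_p ⊗ T_p` has dimension `2` (Remark 7.2).

## References

* J. H. Silverman, *The Arithmetic of Elliptic Curves*, 2nd ed., GTM 106, Springer 2009:
  Cor. III.6.4(b) (p. 86), Prop. III.7.1(a) and Remark 7.2 (p. 88). [SilvermanAEC2009]

## Design

Pure theorems (no new definitions), deliberate dot-notation extensions in
`namespace WeierstrassCurve`; `open scoped Classical` as in the sibling Tate-module files. The case
`L = F̄` of `card_torsionPoints_eq_sq` is produced inline (its general discharge belongs to
`GaloisActionProofs`).
-/

noncomputable section

open scoped Classical

universe u

namespace WeierstrassCurve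


variable {F : Type u} [Field F] (W : WeierstrassCurve F) (p : ℕ) [Fact p.Prime]

/-- **Silverman, *AEC*, Prop. III.7.1(a), discharged**: the named fact `finrank_tateModule_eq_two W p`
— for an elliptic curve `E/F` and a prime `p ≠ char F`, `rank_{ℤ_p} T_p(E) = 2`.
[cite: SilvermanAEC2009, Prop. III.7.1(a)] -/
theorem finrank_tateModule_eq_two_holds : finrank_tateModule_eq_two W p := by
  refine finrank_tateModule_eq_two_of_card_torsionPoints_eq_sq W p ?_
  intro _ _ n hn
  exact (W.baseChange (AlgebraicClosure F)).card_torsionBy_eq_sq hn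

/-- **Silverman, *AEC*, Prop. III.7.1(a) with Remark 7.2, discharged**: the named fact
`finrank_rationalTateModule_eq_two W p` — for an elliptic curve `E/F` and a prime `p ≠ char F`,
`dim_{ℚ_p} V_p(E) = 2`. [cite: SilvermanAEC2009, Prop. III.7.1(a) with Remark 7.2] -/
theorem finrank_rationalTateModule_eq_two_holds : finrank_rationalTateModule_eq_two W p := by
  refine finrank_rationalTateModule_eq_two_of_card_torsionPoints_eq_sq W p ?_
  intro _ _ n hn
  exact (W.baseChange (AlgebraicClosure F)).card_torsionBy_eq_sq hn

/-- `V_p(E)` is finite-dimensional over `ℚ_p` for an elliptic curve `E/F` and a prime `p ≠ char F`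
(Silverman, *AEC*, Prop. III.7.1(a) with Remark 7.2), unconditionally.
[cite: SilvermanAEC2009, Prop. III.7.1(a) with Remark 7.2] -/
theorem finite_rationalTateModule_of_ne_char [W.IsElliptic] (hp : (p : F) ≠ 0) :
    Module.Finite ℚ_[p] (W.rationalTateModule p) := by
  refine finite_rationalTateModule_of_card_torsionPoints_eq_sq W p ?_ hp
  intro _ _ n hn
  exact (W.baseChange (AlgebraicClosure F)).card_torsionBy_eq_sq hn

end WeierstrassCurve
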